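import Summits.QuantumAdvantage.QuantumAdvantage.Theorems.CubicForrelationNearExactIsExactTwelvePartnerR2Blocks
import Summits.QuantumAdvantage.QuantumAdvantage.Theorems.CubicForrelationNearExactIsExactTwelvePartnerLeaves
import Summits.QuantumAdvantage.QuantumAdvantage.Theorems.CubicForrelationNearExactIsExactTwelvePartnerTrace

/-!
# Crux `CubicForrelation.NearExactIsExact` (stmt-QuantumAdvantage-14043) — n = 12, E1280-even, R2 leaf T(a) ASSEMBLED
  (E1280-HANDPROOFS.md §1.2 = R2-PARTNER §4b): frame data + light structure + pairing partner ⇒ contradiction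

Certificate seat `b2b-cforr-cert` (gen 39).  HONEST FRAMING: kernel-checked (standard axioms) end-to-end version of the leaf T(a) in the
coefficient-tensor language.  Cell coordinates `Fin 9 = Fin (3 + 6)`: `U = {s₀,s₁,s₂}` (`Fin.castAdd 6 u`), `F = {s₃..s₈}` (`Fin.natAdd 3 f`).
Frame data: `hF1`; the descendant `t̄ = T = s₀s₁s₂` through its slices (`htbF`: nothing through `F`; `htb0/1/2`: `ι_{s_u} T = s_{u′}∧s_{u″}`);
light structure of sub-case (a): `G ∈ Λ²U*`, i.e. `G` vanishes on `F`-rows (`hG`).  Derivation: (E2) ⇒ `A_UU = B_UU = 0`; the trace of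
(E3) over the nine cell coordinates ⇒ `t := c_{s₀s₁s₂} = 1` (`tpc_trace_mul_alternating`); the `UU`, `FU`, `FF` blocks of (E3) and (E1)
`⟨Γ, B⟩ = 0` are then exactly the hypotheses of `tpl_R2_Ta_core`.  NOT summit progress.
-/

set_option linter.dupNamespace false -- D-0017: single-problem summit ⇒ `QuantumAdvantage.QuantumAdvantage` by design

namespace Summit.QuantumAdvantage.QuantumAdvantage.Theorems.CubicForrelation.NearExactIsExact

open Finset Matrix

/-- Pairing an alternating coefficient matrix against the wedge of two distinct basis covectors picks out one entry. [this work] -/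
theorem tpa_pair_basis_wedge {n : ℕ} (X : Fin n → Fin n → ZMod 2) (a b : Fin n) (hab : a < b) :
    (∑ s, ∑ t, (if s < t then X s t * (if (s = a ∧ t = b) ∨ (s = b ∧ t = a) then 1 else 0) else 0)) = X a b := by
  rw [Finset.sum_eq_single a]
  · rw [Finset.sum_eq_single b]
    · rw [if_pos hab, if_pos (Or.inl ⟨rfl, rfl⟩), mul_one]
    · intro t _ htb
      by_cases hlt : a < t
      · rw [if_pos hlt, if_neg, mul_zero]
        rintro (⟨-, h1⟩ | ⟨-, h1⟩)
        · exact htb h1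
        · rw [h1] at hlt; exact lt_irrefl _ hlt
      · rw [if_neg hlt]
    · intro h0; exact absurd (Finset.mem_univ _) h0
  · intro s _ hsa
    refine Finset.sum_eq_zero fun t _ => ?_
    by_cases hlt : s < t
    · rw [if_pos hlt, if_neg, mul_zero]
      rintro (⟨h1, -⟩ | ⟨h1, h2⟩)
      · exact hsa h1
      · rw [h1, h2] at hlt; exact lt_asymm hab hlt
    · rw [if_neg hlt]
  · intro h0; exact absurd (Finset.mem_univ _) h0

/-- **R2 leaf T(a), assembled.** [this work] -/
theorem tpa_R2_Ta (c d : Fin (3 + 9) → Fin (3 + 9) → Fin (3 + 9) → ZMod 2)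
    (hcs : ∀ p j k, c p k j = c p j k) (hcc : ∀ p j k, c j p k = c p j k) (hcd : ∀ p j, c p j j = 0)
    (hds : ∀ φ j k, d φ k j = d φ j k) (hdc : ∀ φ j k, d j φ k = d φ j k) (hdd : ∀ φ j, d φ j j = 0)
    (hpair : ∀ p φ, (∑ j, ∑ k, (if j < k then c p j k * d φ j k else 0)) = if p = φ then 1 else 0)
    (hF1 : ∀ j k, d (Fin.castAdd 9 0) j k =
      if (j = Fin.castAdd 9 1 ∧ k = Fin.castAdd 9 2) ∨ (j = Fin.castAdd 9 2 ∧ k = Fin.castAdd 9 1) then 1 else 0)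
    (htbF : ∀ (f : Fin 6) (s t : Fin (3 + 6)), d (Fin.natAdd 3 (Fin.natAdd 3 f)) (Fin.natAdd 3 s) (Fin.natAdd 3 t) = 0)
    (htb0 : ∀ s t : Fin (3 + 6), d (Fin.natAdd 3 (Fin.castAdd 6 0)) (Fin.natAdd 3 s) (Fin.natAdd 3 t) =
      if (s = Fin.castAdd 6 1 ∧ t = Fin.castAdd 6 2) ∨ (s = Fin.castAdd 6 2 ∧ t = Fin.castAdd 6 1) then 1 else 0)
    (htb1 : ∀ s t : Fin (3 + 6), d (Fin.natAdd 3 (Fin.castAdd 6 1)) (Fin.natAdd 3 s) (Fin.natAdd 3 t) =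
      if (s = Fin.castAdd 6 0 ∧ t = Fin.castAdd 6 2) ∨ (s = Fin.castAdd 6 2 ∧ t = Fin.castAdd 6 0) then 1 else 0)
    (htb2 : ∀ s t : Fin (3 + 6), d (Fin.natAdd 3 (Fin.castAdd 6 2)) (Fin.natAdd 3 s) (Fin.natAdd 3 t) =
      if (s = Fin.castAdd 6 0 ∧ t = Fin.castAdd 6 1) ∨ (s = Fin.castAdd 6 1 ∧ t = Fin.castAdd 6 0) then 1 else 0)
    (hG : ∀ (f : Fin 6) (s : Fin (3 + 6)), d (Fin.castAdd 9 1) (Fin.natAdd 3 (Fin.natAdd 3 f)) (Fin.natAdd 3 s) = 0) :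
    False := by
  -- abbreviations for the four tensors on the cells
  set A : Fin (3 + 6) → Fin (3 + 6) → ZMod 2 := fun s t => c (Fin.castAdd 9 1) (Fin.natAdd 3 s) (Fin.natAdd 3 t) with hA
  set B : Fin (3 + 6) → Fin (3 + 6) → ZMod 2 := fun s t => c (Fin.castAdd 9 2) (Fin.natAdd 3 s) (Fin.natAdd 3 t) with hB
  set G : Fin (3 + 6) → Fin (3 + 6) → ZMod 2 := fun s t => d (Fin.castAdd 9 1) (Fin.natAdd 3 s) (Fin.natAdd 3 t) with hGd
  set Γ : Fin (3 + 6) → Fin (3 + 6) → ZMod 2 := fun s t => d (Fin.castAdd 9 2) (Fin.natAdd 3 s) (Fin.natAdd 3 t) with hΓ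
  have hAs : ∀ s t, A t s = A s t := fun s t => hcs _ _ _
  have hBs : ∀ s t, B t s = B s t := fun s t => hcs _ _ _
  have hBd : ∀ s, B s s = 0 := fun s => hcd _ _
  have hGs : ∀ s t, G t s = G s t := fun s t => hds _ _ _
  have hΓs' : ∀ s t, Γ t s = Γ s t := fun s t => hds _ _ _
  have hΓd' : ∀ s, Γ s s = 0 := fun s => hdd _ _
  have hGF : ∀ (f : Fin 6) s, G (Fin.natAdd 3 f) s = 0 := fun f s => hG f s
  have hGF' : ∀ s (f : Fin 6), G s (Fin.natAdd 3 f) = 0 := fun s f => by rw [← hGs]; exact hG f s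
  have hE1 := (tpb_E1 c d hcs hcc hcd hds hdc hdd hpair hF1).2.1
  have hE2A := fun f => (tpb_E2 c d hcs hcc hcd hds hdc hdd hpair hF1 f).1
  have hE2B := fun f => (tpb_E2 c d hcs hcc hcd hds hdc hdd hpair hF1 f).2
  have hE3 := tpb_E3 c d hcs hcc hds hdc hdd hpair hF1
  have lt01 : (Fin.castAdd 6 0 : Fin (3 + 6)) < Fin.castAdd 6 1 := by decide
  have lt02 : (Fin.castAdd 6 0 : Fin (3 + 6)) < Fin.castAdd 6 2 := by decide
  have lt12 : (Fin.castAdd 6 1 : Fin (3 + 6)) < Fin.castAdd 6 2 := by decide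
  -- (E2): the U × U blocks of A and B vanish
  have hA12 : A (Fin.castAdd 6 1) (Fin.castAdd 6 2) = 0 := by
    have h := hE2A (Fin.castAdd 6 0); simp only [htb0] at h; rwa [tpa_pair_basis_wedge _ _ _ lt12] at h
  have hA02 : A (Fin.castAdd 6 0) (Fin.castAdd 6 2) = 0 := by
    have h := hE2A (Fin.castAdd 6 1); simp only [htb1] at h; rwa [tpa_pair_basis_wedge _ _ _ lt02] at h
  have hA01 : A (Fin.castAdd 6 0) (Fin.castAdd 6 1) = 0 := by
    have h := hE2A (Fin.castAdd 6 2); simp only [htb2] at h; rwa [tpa_pair_basis_wedge _ _ _ lt01] at h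
  have hB12 : B (Fin.castAdd 6 1) (Fin.castAdd 6 2) = 0 := by
    have h := hE2B (Fin.castAdd 6 0); simp only [htb0] at h; rwa [tpa_pair_basis_wedge _ _ _ lt12] at h
  have hB02 : B (Fin.castAdd 6 0) (Fin.castAdd 6 2) = 0 := by
    have h := hE2B (Fin.castAdd 6 1); simp only [htb1] at h; rwa [tpa_pair_basis_wedge _ _ _ lt02] at h
  have hB01 : B (Fin.castAdd 6 0) (Fin.castAdd 6 1) = 0 := by
    have h := hE2B (Fin.castAdd 6 2); simp only [htb2] at h; rwa [tpa_pair_basis_wedge _ _ _ lt01] at h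
  have hAUU : ∀ u u' : Fin 3, A (Fin.castAdd 6 u) (Fin.castAdd 6 u') = 0 := by
    intro u u'
    fin_cases u <;> fin_cases u'
    all_goals first
      | exact hcd _ _
      | exact hA01 | exact hA02 | exact hA12
      | (rw [hAs]; first | exact hA01 | exact hA02 | exact hA12)
  have hBUU : ∀ u u' : Fin 3, B (Fin.castAdd 6 u) (Fin.castAdd 6 u') = 0 := by
    intro u u'
    fin_cases u <;> fin_cases u'
    all_goals first
      | exact hcd _ _
      | exact hB01 | exact hB02 | exact hB12
      | (rw [hBs]; first | exact hB01 | exact hB02 | exact hB12)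
  -- the τ term of (E3): zero on F-rows, and on U-rows it is `[x = u]·t` with t = c_{s₀s₁s₂}
  set t : ZMod 2 := c (Fin.natAdd 3 (Fin.castAdd 6 0)) (Fin.natAdd 3 (Fin.castAdd 6 1)) (Fin.natAdd 3 (Fin.castAdd 6 2)) with ht
  have hcS := tpb_diag12 c hcs hcc hcd
  have ht_perm1 : c (Fin.natAdd 3 (Fin.castAdd 6 1)) (Fin.natAdd 3 (Fin.castAdd 6 0)) (Fin.natAdd 3 (Fin.castAdd 6 2)) = t := by
    rw [ht, hcc]
  have ht_perm2 : c (Fin.natAdd 3 (Fin.castAdd 6 2)) (Fin.natAdd 3 (Fin.castAdd 6 0)) (Fin.natAdd 3 (Fin.castAdd 6 1)) = t := by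
    rw [ht, hcc, hcs, hcc]
  have hτUU : ∀ u₁ u₂ : Fin 3,
      (∑ s, ∑ r, (if s < r then c (Fin.natAdd 3 (Fin.castAdd 6 u₂)) (Fin.natAdd 3 s) (Fin.natAdd 3 r) *
        d (Fin.natAdd 3 (Fin.castAdd 6 u₁)) (Fin.natAdd 3 s) (Fin.natAdd 3 r) else 0)) =
      if u₁ = u₂ then t else 0 := by
    intro u₁ u₂
    fin_cases u₁
    · simp only [htb0, Fin.zero_eta, Fin.isValue]
      rw [tpa_pair_basis_wedge (fun s r => c (Fin.natAdd 3 (Fin.castAdd 6 u₂)) (Fin.natAdd 3 s) (Fin.natAdd 3 r)) _ _ lt12]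
      fin_cases u₂
      · simp only [Fin.zero_eta, Fin.isValue, if_true]; exact ht.symm ▸ rfl
      · simp only [Fin.mk_one, Fin.isValue, show ¬ ((0 : Fin 3) = 1) by decide, if_false]; exact (hcS _ _).1
      · simp only [Fin.reduceFinMk, Fin.isValue, show ¬ ((0 : Fin 3) = 2) by decide, if_false]; exact (hcS _ _).2
    · simp only [htb1, Fin.mk_one, Fin.isValue]
      rw [tpa_pair_basis_wedge (fun s r => c (Fin.natAdd 3 (Fin.castAdd 6 u₂)) (Fin.natAdd 3 s) (Fin.natAdd 3 r)) _ _ lt02]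
      fin_cases u₂
      · simp only [Fin.zero_eta, Fin.isValue, show ¬ ((1 : Fin 3) = 0) by decide, if_false]; exact (hcS _ _).1
      · simp only [Fin.mk_one, Fin.isValue, if_true]; exact ht_perm1
      · simp only [Fin.reduceFinMk, Fin.isValue, show ¬ ((1 : Fin 3) = 2) by decide, if_false]; exact (hcS _ _).2
    · simp only [htb2, Fin.reduceFinMk, Fin.isValue]
      rw [tpa_pair_basis_wedge (fun s r => c (Fin.natAdd 3 (Fin.castAdd 6 u₂)) (Fin.natAdd 3 s) (Fin.natAdd 3 r)) _ _ lt01]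
      fin_cases u₂
      · simp only [Fin.zero_eta, Fin.isValue, show ¬ ((2 : Fin 3) = 0) by decide, if_false]; exact (hcS _ _).1
      · simp only [Fin.mk_one, Fin.isValue, show ¬ ((2 : Fin 3) = 1) by decide, if_false]; exact (hcS _ _).2
      · simp only [Fin.reduceFinMk, Fin.isValue, if_true]; exact ht_perm2
  have hτF : ∀ (f : Fin 6) (x : Fin (3 + 6)),
      (∑ s, ∑ r, (if s < r then c (Fin.natAdd 3 x) (Fin.natAdd 3 s) (Fin.natAdd 3 r) *
        d (Fin.natAdd 3 (Fin.natAdd 3 f)) (Fin.natAdd 3 s) (Fin.natAdd 3 r) else 0)) = 0 :=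
    fun f x => Finset.sum_eq_zero fun s _ => Finset.sum_eq_zero fun r _ => by rw [htbF, mul_zero, ite_self]
  -- (E3) restated with the abbreviations
  have hE3' : ∀ f x : Fin (3 + 6), (∑ s, (G f s * A s x + Γ f s * B s x)) +
      (∑ s, ∑ r, (if s < r then c (Fin.natAdd 3 x) (Fin.natAdd 3 s) (Fin.natAdd 3 r) *
        d (Fin.natAdd 3 f) (Fin.natAdd 3 s) (Fin.natAdd 3 r) else 0)) = if f = x then 1 else 0 := fun f x => hE3 f x
  -- TRACE: t = 1
  have ht1 : t = 1 := by
    have hsum : (∑ x : Fin (3 + 6), ((∑ s, (G x s * A s x + Γ x s * B s x)) +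
        (∑ s, ∑ r, (if s < r then c (Fin.natAdd 3 x) (Fin.natAdd 3 s) (Fin.natAdd 3 r) *
          d (Fin.natAdd 3 x) (Fin.natAdd 3 s) (Fin.natAdd 3 r) else 0)))) = ∑ x : Fin (3 + 6), (1 : ZMod 2) :=
      Finset.sum_congr rfl fun x _ => by rw [hE3' x x, if_pos rfl]
    have h9 : (∑ x : Fin (3 + 6), (1 : ZMod 2)) = 1 := by simp; decide
    rw [h9, Finset.sum_add_distrib] at hsum
    -- the trace terms vanish
    have hGA : (∑ x : Fin (3 + 6), ∑ s, G x s * A s x) = 0 := by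
      have h := tpc_trace_mul_alternating (Matrix.of fun x s => G x s) (Matrix.of fun s x => A s x)
        (fun i => hdd _ _) (by ext i j; simp only [Matrix.transpose_apply, Matrix.of_apply]; exact hGs i j)
        (by ext i j; simp only [Matrix.transpose_apply, Matrix.of_apply]; exact hAs i j)
      simpa [Matrix.trace, Matrix.mul_apply] using h
    have hΓB : (∑ x : Fin (3 + 6), ∑ s, Γ x s * B s x) = 0 := by
      have h := tpc_trace_mul_alternating (Matrix.of fun x s => Γ x s) (Matrix.of fun s x => B s x)
        (fun i => hdd _ _) (by ext i j; simp only [Matrix.transpose_apply, Matrix.of_apply]; exact hΓs' i j)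
        (by ext i j; simp only [Matrix.transpose_apply, Matrix.of_apply]; exact hBs i j)
      simpa [Matrix.trace, Matrix.mul_apply] using h
    have hfirst : (∑ x : Fin (3 + 6), ∑ s, (G x s * A s x + Γ x s * B s x)) = 0 := by
      rw [Finset.sum_congr rfl fun x _ => Finset.sum_add_distrib, Finset.sum_add_distrib, hGA, hΓB, add_zero]
    rw [hfirst, zero_add, Fin.sum_univ_add] at hsum
    rw [Finset.sum_eq_zero (fun f _ => hτF f (Fin.natAdd 3 f)), add_zero, Fin.sum_univ_three,
      hτUU 0 0, hτUU 1 1, hτUU 2 2, if_pos rfl, if_pos rfl, if_pos rfl] at hsum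
    revert hsum; generalize t = t'; revert t'; decide
  -- the blocks
  set ΓUF : Matrix (Fin 3) (Fin 6) (ZMod 2) := Matrix.of fun u f => Γ (Fin.castAdd 6 u) (Fin.natAdd 3 f) with hΓUF
  set ΓFF : Matrix (Fin 6) (Fin 6) (ZMod 2) := Matrix.of fun f f' => Γ (Fin.natAdd 3 f) (Fin.natAdd 3 f') with hΓFF
  set BUF : Matrix (Fin 3) (Fin 6) (ZMod 2) := Matrix.of fun u f => B (Fin.castAdd 6 u) (Fin.natAdd 3 f) with hBUF
  set BFF : Matrix (Fin 6) (Fin 6) (ZMod 2) := Matrix.of fun f f' => B (Fin.natAdd 3 f) (Fin.natAdd 3 f') with hBFF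
  -- the G-part of (E3) vanishes whenever the row is in F or the column is in U
  have hGsumU : ∀ (f : Fin (3 + 6)) (u : Fin 3), (∑ s, G f s * A s (Fin.castAdd 6 u)) = 0 := by
    intro f u
    rw [Fin.sum_univ_add]
    rw [Finset.sum_eq_zero (fun u' _ => by rw [hAUU, mul_zero]), Finset.sum_eq_zero (fun f' _ => by rw [hGF', zero_mul]), add_zero]
  have hGsumF : ∀ (f : Fin 6) (x : Fin (3 + 6)), (∑ s, G (Fin.natAdd 3 f) s * A s x) = 0 :=
    fun f x => Finset.sum_eq_zero fun s _ => by rw [hGF, zero_mul]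
  have hUU : ΓUF * BUFᵀ = 0 := by
    ext u₁ u₂
    have h := hE3' (Fin.castAdd 6 u₁) (Fin.castAdd 6 u₂)
    rw [hτUU, ht1, Finset.sum_add_distrib, hGsumU, zero_add, Fin.sum_univ_add,
      Finset.sum_eq_zero (fun u' _ => by rw [hBUU, mul_zero]), zero_add] at h
    have hiff : (Fin.castAdd 6 u₁ : Fin (3 + 6)) = Fin.castAdd 6 u₂ ↔ u₁ = u₂ :=
      ⟨fun h' => Fin.castAdd_injective _ _ h', fun h' => h' ▸ rfl⟩
    simp only [hiff] at h
    rw [Matrix.mul_apply, Matrix.zero_apply]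
    simp only [hΓUF, hBUF, Matrix.transpose_apply, Matrix.of_apply]
    have : (∑ f : Fin 6, Γ (Fin.castAdd 6 u₁) (Fin.natAdd 3 f) * B (Fin.natAdd 3 f) (Fin.castAdd 6 u₂)) = 0 := by
      by_cases h12 : u₁ = u₂
      · rw [if_pos h12] at h; exact add_eq_right.mp h
      · rw [if_neg h12, add_zero] at h; exact h
    rw [← this]
    exact Finset.sum_congr rfl fun f _ => by rw [hBs]
  have hFU : ΓFF * BUFᵀ = 0 := by
    ext f u
    have h := hE3' (Fin.natAdd 3 f) (Fin.castAdd 6 u)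
    have hne : (Fin.natAdd 3 f : Fin (3 + 6)) ≠ Fin.castAdd 6 u := fun h' => by
      have := congrArg Fin.val h'; simp only [Fin.val_natAdd, Fin.val_castAdd] at this; omega
    rw [hτF, if_neg hne, add_zero, Finset.sum_add_distrib, hGsumF, zero_add, Fin.sum_univ_add,
      Finset.sum_eq_zero (fun u' _ => by rw [hBUU, mul_zero]), zero_add] at h
    rw [Matrix.mul_apply, Matrix.zero_apply]
    simp only [hΓFF, hBUF, Matrix.transpose_apply, Matrix.of_apply]
    rw [← h]
    exact Finset.sum_congr rfl fun f' _ => by rw [hBs]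
  have hFF : ΓUFᵀ * BUF + ΓFF * BFF = 1 := by
    ext f₁ f₂
    have h := hE3' (Fin.natAdd 3 f₁) (Fin.natAdd 3 f₂)
    have hiff : (Fin.natAdd 3 f₁ : Fin (3 + 6)) = Fin.natAdd 3 f₂ ↔ f₁ = f₂ :=
      ⟨fun h' => by have := congrArg Fin.val h'; simp only [Fin.val_natAdd] at this; exact Fin.ext (by omega), fun h' => h' ▸ rfl⟩
    rw [hτF, add_zero, Finset.sum_add_distrib, hGsumF, zero_add, Fin.sum_univ_add] at h
    rw [Matrix.add_apply, Matrix.mul_apply, Matrix.mul_apply, Matrix.one_apply]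
    simp only [hΓUF, hΓFF, hBUF, hBFF, Matrix.transpose_apply, Matrix.of_apply]
    simp only [hiff] at h
    rw [← h]
    congr 1
    exact Finset.sum_congr rfl fun u _ => by rw [hΓs']
  have hpair' : (∑ u, ∑ f, ΓUF u f * BUF u f) + (∑ i, ∑ j, if i < j then BFF i j * ΓFF i j else 0) = 0 := by
    set F : Fin (3 + 6) → Fin (3 + 6) → ZMod 2 := fun s r => c (Fin.castAdd 9 2) (Fin.natAdd 3 s) (Fin.natAdd 3 r) *
      d (Fin.castAdd 9 2) (Fin.natAdd 3 s) (Fin.natAdd 3 r) with hF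
    have h : (∑ s : Fin (3 + 6), ∑ r : Fin (3 + 6), (if s < r then F s r else 0)) = 0 := hE1
    rw [tpb_sum_lt_split (n := 6) F] at h
    have hY : F (Fin.castAdd 6 0) (Fin.castAdd 6 1) + F (Fin.castAdd 6 0) (Fin.castAdd 6 2) + F (Fin.castAdd 6 1) (Fin.castAdd 6 2) = 0 := by
      have e01 : F (Fin.castAdd 6 0) (Fin.castAdd 6 1) = 0 := by simp only [hF]; rw [show c _ _ _ = B _ _ from rfl, hB01, zero_mul]
      have e02 : F (Fin.castAdd 6 0) (Fin.castAdd 6 2) = 0 := by simp only [hF]; rw [show c _ _ _ = B _ _ from rfl, hB02, zero_mul]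
      have e12 : F (Fin.castAdd 6 1) (Fin.castAdd 6 2) = 0 := by simp only [hF]; rw [show c _ _ _ = B _ _ from rfl, hB12, zero_mul]
      rw [e01, e02, e12, add_zero, add_zero]
    rw [hY, zero_add] at h
    have hL : (∑ u, ∑ f, ΓUF u f * BUF u f) =
        ∑ s : Fin 6, (F (Fin.castAdd 6 0) (Fin.natAdd 3 s) + F (Fin.castAdd 6 1) (Fin.natAdd 3 s) + F (Fin.castAdd 6 2) (Fin.natAdd 3 s)) := by
      rw [Fin.sum_univ_three, ← Finset.sum_add_distrib, ← Finset.sum_add_distrib]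
      refine Finset.sum_congr rfl fun f _ => ?_
      simp only [hΓUF, hBUF, hF, hΓ, hB, Matrix.of_apply]
      ring
    have hR : (∑ i, ∑ j, if i < j then BFF i j * ΓFF i j else 0) = ∑ s : Fin 6, ∑ r : Fin 6, (if s < r then F (Fin.natAdd 3 s) (Fin.natAdd 3 r) else 0) := by
      refine Finset.sum_congr rfl fun i _ => Finset.sum_congr rfl fun j _ => ?_
      by_cases hij : i < j
      · rw [if_pos hij, if_pos hij]; simp only [hBFF, hΓFF, hF, hΓ, hB, Matrix.of_apply]
      · rw [if_neg hij, if_neg hij]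
    rw [hL, hR]
    exact h
  have hΓFFs : ΓFFᵀ = ΓFF := by ext i j; simp only [hΓFF, Matrix.transpose_apply, Matrix.of_apply]; exact hΓs' _ _
  have hΓFFd : ∀ i, ΓFF i i = 0 := fun i => by simp only [hΓFF, Matrix.of_apply]; exact hΓd' _
  exact tpl_R2_Ta_core ΓUF BUF ΓFF BFF hΓFFs hΓFFd hFU hUU hFF hpair'

end Summit.QuantumAdvantage.QuantumAdvantage.Theorems.CubicForrelation.NearExactIsExact
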